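import Summits.QuantumAdvantage.QuantumAdvantage.Theses.ArithStatLadder
import Literature.NumberTheory.QuadraticFields.ThreeTorsion
import Literature.NumberTheory.QuadraticFields.ThreeTorsionMean
import Literature.NumberTheory.QuadraticFields.ThreeTorsionMeanProofs
import Literature.NumberTheory.QuadraticFields.SquarefreeModFour
import Summits.QuantumAdvantage.QuantumAdvantage.Theorems.AvgFaceBeyondPrior.Negative.AvgFaceBeyondPriorBlocks
import Summits.QuantumAdvantage.QuantumAdvantage.Theorems.AvgFaceBeyondPrior.Negative.AvgFaceBeyondPriorNecessary

/-!
# Line `moment-lp-density-floor` for crux `AvgFaceBeyondPrior` (stmt-QuantumAdvantage-2427) — v2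

Route `ArithStatLadder`; crux decl
`Summit.QuantumAdvantage.QuantumAdvantage.Theses.ArithStatLadder.AvgFaceBeyondPrior` =
`(IQ3, U) ∉ Heur_{1/3}BPP` (IQ3 = {bin d : −d fundamental, 3 ∣ h(−d)}, `Uₙ` uniform on the n-bit `d`
with `−d` fundamental). Idea card `Cruxes/AvgFaceBeyondPrior/Ideas/moment-lp-density-floor.md`, triage
`TRIAGE-r1-{1,2,3}.md` (pass ×3), line card `Lines/moment-lp-density-floor.md`.

v2 (gen-2 planner, 2026-08-16): v1's stub `stub_windowMeanTwo` (Davenport–Heilbronn ON DYADIC WINDOWS) is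
replaced by `stub_dhMeanImaginary` = the Davenport–Heilbronn mean VERBATIM as vendored
(`bst_threeTorsion_mean.neg`; same registered name + signature as in the sibling line
`Lines/cubic_discriminant_pseudorandomness.lean`, so the two lines now SHARE two of their stubs), and the
dyadic-window form is DERIVED here (`windowMeanTwo_of_dh`, proved: `S(X)/X → 6/π²`, `N(X)/X → 3/π²`,
difference along `X = 2ⁿ⁻¹, 2ⁿ`). New §6: the two arithmetic stubs deliver the landed necessity lemma's
conclusion (`Negative.avgFace_imp_exists_level`) at every large level (`existsLevel_of_moments`, proved).

## Shape

Write `𝒲ₙ := negFundDiscrs (2^n) \ negFundDiscrs (2^(n-1))` (the fundamental discriminants `D` with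
`−2ⁿ < D ≤ −2ⁿ⁻¹`, i.e. `D = −d` for `d` in the route's dyadic block `fundBlock n`) and
`t = quadFieldThreeTorsion` (`#Cl₃`, a power of `3`; `3 ∣ h(−d) ↔ 1 < t(−d)`, tree lemmas). Three
REGISTERED STUBS, all stated over existing Literature declarations only:

* `stub_dhMeanImaginary`   — Davenport–Heilbronn 1971 Thm 3 / BST Cor. 7, imaginary half:
  `Σ_{−X<D<0} t / #{−X<D<0} → 2` (IN PRINT; literally the vendored fact's first conjunct — closes by the
  one-line citation `h.neg` the day the fact is a theorem of the tree, cf. `dhMeanImaginary_of_fact`;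
  SHARED with the sibling planting line).
* `stub_secondMomentBelow` — THE LOAD-BEARING ARITHMETIC STUB: `∃ M₂ < 23/3, ∀ᶠ n, Σ_{𝒲ₙ} t² ≤ M₂·#𝒲ₙ`
  (OPEN: Cohen–Lenstra predict `M₂ → 6`; known `Σ_{|D|<X} t² ≪ X^{23/18+ε}`, Heath-Brown–Pierce 2017;
  SHARED with the sibling planting line).
* `stub_noPPTConcentration` — the computational stub (hypothesis-type, ≥ `NP ⊄ BPP` jointly with the
  others; barrier `SeparationPrerequisites`): for every PPT `A` and `ε > 0`, for infinitely many `n`,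
  `Σ_{D ∈ 𝒲ₙ, Pr[A(bin |D|, 1ⁿ) = 1] > 3/4} (t(D) − 2) ≤ ε·#𝒲ₙ` — cubic fields do not pile up on any
  set of discriminants a PPT algorithm confidently accepts (one-sided, thresholded, `∃ᶠ`: the weakest
  form the glue consumes; it makes the glue amplification-free). THIS is where the line differs from
  the sibling (whose complexity stub is the two-ensemble `∀ᶠ` pseudorandomness `stub_prgCubic` plus an
  amplification stub).

PROVED here (no sorry outside the stubs):
* `windowMeanTwo_of_dh`: S1 ⇒ `Σ_{𝒲ₙ} t / #𝒲ₙ → 2` (differencing with the PROVED density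
  `tendsto_card_negFundDiscrs_div`);
* the moment LP `12Σt − Σt² − 11·#S ≤ 16·#{1 < t}` on powers of three (after triage-2's
  `TriageK2-LPLemma.lean`) and `densityFloor_of_moments`: window-DH ∧ S2 ⇒ `∃ η > 0, ∀ᶠ n, #𝒲ₙ > 0 ∧
  (1/3 + η)·#𝒲ₙ ≤ #{D ∈ 𝒲ₙ : 1 < t D}` (density of `3 ∣ h` beyond the `1/3` of the crux);
* `comb_core` + `core`: a `Heur_{1/3}` PPT algorithm `A` (bad mass ≤ 1/3 at EVERY level) confidently
  accepts a set `S_A` with `Σ_{S_A}(t − 2) ≥ #{3 ∣ h} − #bad ≥ η·#𝒲ₙ` eventually, contradicting S3;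
  stated for an ABSTRACT window/language given by membership specs, so that nothing depends on the
  `Decidable` instances inside the route's literal finset;
* `AvgFaceBeyondPrior_of : AvgFaceBeyondPrior` — concludes the crux BY NAME from the three stubs;
* `existsLevel_of_moments`: S1 ∧ S2 ⇒ `∀ᶠ n, #fundBlock n < 3·#{d ∈ fundBlock n : 3 ∣ h(−d)}` — the
  conclusion of the landed `Negative.avgFace_imp_exists_level` (crux ⇒ ∃ such n), at every large level.

Disproof.lean obligations honoured: `avgFace_imp_exists_level(_ge)` (density > 1/3 necessary) is
delivered by S1+S2 through the LP (stronger: eventually, with margin η = (23/3 − M₂)/32; §6 states it in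
the Disproof's own terms); `not_avgFace_without_PPT` — polynomial time enters only through S3;
`not_avgFace_unconditioned` / landed `Negative/AvgFaceBeyondPriorBlocks` — everything is relative to the
fundamental window, no domination transfer; no stub is an instance of a landed Negative lemma (both
Negative modules are imported here, so the check is by elaboration, not by reading).
-/

noncomputable section

set_option linter.dupNamespace false

namespace Summit.QuantumAdvantage.QuantumAdvantage.Cruxes.AvgFaceBeyondPrior.MomentLpDensityFloor

open Filter Finset
open scoped Topology Classical
open _root_.Computability
open Literature.Computability.Complexity Literature.Computability.MetaComplexity
open Literature.NumberTheory.QuadraticFields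
open Summit.QuantumAdvantage.QuantumAdvantage.Theses.ArithStatLadder (AvgFaceBeyondPrior)
open Summit.QuantumAdvantage.QuantumAdvantage.Theorems.AvgFaceBeyondPrior.Negative (fundBlock)

/-! ## §1 The three registered stubs -/

/-- **S1 (support-grade, IN PRINT; shared verbatim with line `cubic-discriminant-pseudorandomness`):
Davenport–Heilbronn, imaginary quadratic fields.** The mean of `#Cl₃(D)` over the fundamental
discriminants `−X < D < 0` tends to `2` (DavenportHeilbronn1971 Thm 3; BhargavaShankarTsimerman2012
Cor. 7; with an `X^{5/6}` secondary term, BhargavaTaniguchiThorne2023 Thm 1.2). LITERALLY the imaginary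
half of the vendored named fact: given `h : bst_threeTorsion_mean` it is `h.neg`
(`dhMeanImaginary_of_fact` below), equivalently `(bst_threeTorsion_mean_of_btt_threeTorsion_sum h').neg`
from the vendored BTT Thm 1.2 — so it closes by that one-line citation the day the tree's CFT-free
Davenport–Heilbronn road (`Literature/NumberTheory/CubicFields/DavenportHeilbronn*`,
`ThreeTorsionParametrization*`) lands the fact as a theorem; until then the line ends "closed modulo DH"
on this stub. The DYADIC-WINDOW form the line consumes is DERIVED from it in §1b
(`windowMeanTwo_of_dh`, PROVED). [cite: BhargavaShankarTsimerman2012, Cor. 7] -/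
theorem stub_dhMeanImaginary :
    Tendsto (fun X : ℕ =>
      (∑ D ∈ negFundDiscrs X, (quadFieldThreeTorsion D : ℝ)) / ((negFundDiscrs X).card : ℝ)) atTop (𝓝 2) := by
  sorry

/-- **S2 (THE load-bearing arithmetic stub, OPEN): a second moment below `23/3` on dyadic windows.**
Some `M₂ < 23/3` bounds `Σ_{𝒲ₙ} #Cl₃(D)² ≤ M₂ · #𝒲ₙ` for all large `n`. Cohen–Lenstra predict the
second moment tends to `6` (= number of subgroups of `(ℤ/3)²`; CohenLenstra1984 §9.I); an UPPER bound
with 27 % slack suffices here. It is stated on DYADIC WINDOWS `|D| ∈ [2ⁿ⁻¹, 2ⁿ)` — the weakest form the LP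
consumes; counting methods localise to `|D| ∈ (X/2, X]` verbatim. A FULL-RANGE bound also suffices, with a
tighter constant: if `limsup_X Σ_{−X<D<0} t² / #{−X<D<0} ≤ M` then, differencing against the LP's own lower
bound on the inner range (`Σ_{<X} t² ≥ 12Σt − 11N − 16#{1<t} ≥ (4m(X) − 3)·N(X) → 5N(X)`, using
`2#{1<t} ≤ Σt − N`), the window constant is `≤ 2M − 5 + o(1)`, so `M < 19/3 ≈ 6.33` is enough (Cohen–Lenstra:
`6`; margin 5 %, against 27 % for the window form). Known: `Σ_{−X<D<0} #Cl₃(D)² ≪ X^{23/18+ε}`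
(HeathbrownPierce2017, Cor. 1.4); the milestone `≪ X` with ANY constant is itself open since 1971. Numerics (kit j010830,
j011217, crux evidence): window second moments `5.08, 5.17, 5.26` at `n = 20, 21, 22`, `5.15` on
`[10⁶, 1.3·10⁶)` — margin `> 2.4` to `23/3` at every computed height (the margin the LP needs, not CL's
exact `6`). The threshold is sharp for two-moment arguments: the law `p₁ = (M₂+3)/16, p₃ = 1/2 −
(M₂−5)/12, p₉ = (M₂−5)/48` has mean `2`, second moment `M₂` and `P(t ≥ 3) = (13 − M₂)/16` (triage-2).
[cite: HeathbrownPierce2017, Cor. 1.4] [cite: CohenLenstra1984, §9.I (C6)] -/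
theorem stub_secondMomentBelow :
    ∃ M₂ : ℝ, M₂ < 23 / 3 ∧ ∀ᶠ n : ℕ in atTop,
      ∑ D ∈ negFundDiscrs (2 ^ n) \ negFundDiscrs (2 ^ (n - 1)), ((quadFieldThreeTorsion D : ℝ)) ^ 2
        ≤ M₂ * ((negFundDiscrs (2 ^ n) \ negFundDiscrs (2 ^ (n - 1))).card : ℝ) := by
  sorry

/-- **S3 (computational stub, hypothesis-type): no PPT-recognisable concentration of cubic fields.**
For every probabilistic polynomial-time `A(x, 1ⁿ)` and every `ε > 0`, for infinitely many `n`: on the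
set of window discriminants that `A` ACCEPTS WITH PROBABILITY `> 3/4` (input `bin |D|`, LSB first, as in
the route's ensemble), the excess `Σ (#Cl₃(D) − 2)` is at most `ε · #𝒲ₙ`. Equivalently: along no
infinite tail of levels does a PPT algorithm confidently select a set of discriminants on which cubic
fields (density `(#Cl₃ − 1)/2` each, Hasse) over-concentrate by a positive fraction of the window.
One-sided, thresholded and `∃ᶠ` — the weakest form the glue `core` consumes (triage-2 sharpening): no
amplification, no `WindowMeanTwo`, no CFT dictionary is needed to consume it; the two-sided `∀ᶠ`
correlation form `PPTRung` of `SketchIdeator2.lean` implies it (threshold the statistic). Sanity: for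
`A ≡ accept` it reads `liminf (m₁(n) − 2) ≤ 0` (true by S1); for `A` deciding a residue class or a
digit cylinder it is Davenport–Heilbronn with local conditions (route rungs `EndJuntaRung`/`DigitRung`);
without the time bound it is FALSE (`A = 𝟙_{IQ3}` gives `Σ ≥ #IQ3ₙ ≈ 0.44·#𝒲ₙ`), matching Disproof
`not_avgFace_without_PPT`. Separation-strength jointly with S1/S2 (the crux gives `IQ3 ∉ BPP`, Disproof
`avgFace_imp_not_mem_BPP`, and `IQ3 ∈ NP`); barrier
`Literature.Barriers.QuantumAdvantage.SeparationPrerequisites` applies and is NOT evaded: hypothesis-type,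
refuters first, do not staff provers on it. [folklore] -/
theorem stub_noPPTConcentration :
    ∀ A : RandAlg (List Bool × ℕ) Bool, A.IsPolyTime paramEnc encodeBool →
      ∀ ε : ℝ, 0 < ε → ∃ᶠ n : ℕ in atTop,
        ∑ D ∈ (negFundDiscrs (2 ^ n) \ negFundDiscrs (2 ^ (n - 1))).filter
            (fun D => 3 / 4 < A.pr paramEnc (encodeNat D.natAbs, n) {true}),
          ((quadFieldThreeTorsion D : ℝ) - 2)
        ≤ ε * ((negFundDiscrs (2 ^ n) \ negFundDiscrs (2 ^ (n - 1))).card : ℝ) := by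
  sorry

/-! ## §1b Davenport–Heilbronn on dyadic windows from the plain mean (proved; v1's `stub_windowMeanTwo`) -/

/-- How S1 closes modulo the vendored named fact: it is its imaginary half.
[cite: BhargavaShankarTsimerman2012, Cor. 7] -/
theorem dhMeanImaginary_of_fact (h : bst_threeTorsion_mean) :
    Tendsto (fun X : ℕ =>
      (∑ D ∈ negFundDiscrs X, (quadFieldThreeTorsion D : ℝ)) / ((negFundDiscrs X).card : ℝ)) atTop (𝓝 2) :=
  h.neg

/-- `negFundDiscrs` is monotone in `X`. [folklore] -/
theorem negFundDiscrs_mono {X Y : ℕ} (h : X ≤ Y) : negFundDiscrs X ⊆ negFundDiscrs Y := by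
  intro D hD
  rw [mem_negFundDiscrs] at hD ⊢
  exact ⟨⟨by omega, hD.1.2⟩, hD.2⟩

/-- `−3 ∈ negFundDiscrs X` for `X ≥ 4`, so these sets are eventually nonempty. [folklore] -/
theorem card_negFundDiscrs_pos {X : ℕ} (hX : 4 ≤ X) : 0 < (negFundDiscrs X).card := by
  rw [Finset.card_pos]
  refine ⟨-3, ?_⟩
  rw [mem_negFundDiscrs]
  refine ⟨⟨by omega, by norm_num⟩, Or.inl ⟨by decide, ?_, by norm_num⟩⟩
  rw [← Int.squarefree_natAbs]
  exact Nat.prime_three.prime.squarefree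

/-- `Σ_{−X<D<0} #Cl₃(D) / X → 2·(3/π²)`: the Davenport–Heilbronn mean times the PROVED density of
fundamental discriminants `#negFundDiscrs X / X → 3/π²` (`tendsto_card_negFundDiscrs_div`, from
`abs_card_negFundDiscrs_sub_le`: `|#negFundDiscrs X − (3/π²)X| ≤ 8√X`). [folklore] -/
theorem tendsto_sum_div_of_dh
    (h : Tendsto (fun X : ℕ =>
      (∑ D ∈ negFundDiscrs X, (quadFieldThreeTorsion D : ℝ)) / ((negFundDiscrs X).card : ℝ)) atTop (𝓝 2)) :
    Tendsto (fun X : ℕ => (∑ D ∈ negFundDiscrs X, (quadFieldThreeTorsion D : ℝ)) / (X : ℝ)) atTop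
      (𝓝 (2 * (3 / Real.pi ^ 2))) := by
  refine (h.mul tendsto_card_negFundDiscrs_div).congr' ?_
  filter_upwards [eventually_ge_atTop 4] with X hX
  have hN : ((negFundDiscrs X).card : ℝ) ≠ 0 := by
    exact_mod_cast (card_negFundDiscrs_pos hX).ne'
  show (∑ D ∈ negFundDiscrs X, (quadFieldThreeTorsion D : ℝ)) / ((negFundDiscrs X).card : ℝ)
      * (((negFundDiscrs X).card : ℝ) / (X : ℝ))
    = (∑ D ∈ negFundDiscrs X, (quadFieldThreeTorsion D : ℝ)) / (X : ℝ)
  rw [div_mul_div_comm, mul_comm ((negFundDiscrs X).card : ℝ) (X : ℝ), mul_div_mul_right _ _ hN]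

/-- The window sum is a difference of two initial sums. [folklore] -/
theorem sum_window_eq_sub (n : ℕ) (g : ℤ → ℝ) :
    ∑ D ∈ negFundDiscrs (2 ^ n) \ negFundDiscrs (2 ^ (n - 1)), g D
      = ∑ D ∈ negFundDiscrs (2 ^ n), g D - ∑ D ∈ negFundDiscrs (2 ^ (n - 1)), g D :=
  Finset.sum_sdiff_eq_sub (negFundDiscrs_mono (Nat.pow_le_pow_right (by norm_num) (Nat.sub_le n 1)))

/-- The window count is a difference of two initial counts. [folklore] -/
theorem card_window_eq_sub (n : ℕ) :
    ((negFundDiscrs (2 ^ n) \ negFundDiscrs (2 ^ (n - 1))).card : ℝ)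
      = ((negFundDiscrs (2 ^ n)).card : ℝ) - ((negFundDiscrs (2 ^ (n - 1))).card : ℝ) := by
  have hsub : negFundDiscrs (2 ^ (n - 1)) ⊆ negFundDiscrs (2 ^ n) :=
    negFundDiscrs_mono (Nat.pow_le_pow_right (by norm_num) (Nat.sub_le n 1))
  have h := Finset.card_sdiff_add_card_eq_card hsub
  have h' : ((negFundDiscrs (2 ^ n) \ negFundDiscrs (2 ^ (n - 1))).card : ℝ)
      + ((negFundDiscrs (2 ^ (n - 1))).card : ℝ) = ((negFundDiscrs (2 ^ n)).card : ℝ) := by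
    exact_mod_cast h
  linarith

/-- Pure-real identity behind the differencing: dividing numerator and denominator by the half-width.
[folklore] -/
theorem window_ratio_identity {S₁ S₀ N₁ N₀ P : ℝ} (hP : P ≠ 0) :
    (2 * (S₁ / (2 * P)) - S₀ / P) / (2 * (N₁ / (2 * P)) - N₀ / P) = (S₁ - S₀) / (N₁ - N₀) := by
  have e₁ : 2 * (S₁ / (2 * P)) - S₀ / P = (S₁ - S₀) / P := by
    rw [mul_div_assoc', mul_div_mul_left S₁ P two_ne_zero, sub_div]
  have e₀ : 2 * (N₁ / (2 * P)) - N₀ / P = (N₁ - N₀) / P := by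
    rw [mul_div_assoc', mul_div_mul_left N₁ P two_ne_zero, sub_div]
  rw [e₁, e₀, div_div_div_cancel_right₀ hP]

/-- **Davenport–Heilbronn on dyadic windows** (v1's `stub_windowMeanTwo`, now DERIVED from S1): if the
mean of `#Cl₃` over `−X < D < 0` tends to `2` then so does the mean over the windows `−2ⁿ < D ≤ −2ⁿ⁻¹`.
With `c = 3/π²`: `S(X)/X → 2c` (`tendsto_sum_div_of_dh`) and `N(X)/X → c` (PROVED count), so along
`X = 2ⁿ⁻¹`: `Σ_{𝒲ₙ} t / #𝒲ₙ = (S(2X) − S(X))/(N(2X) − N(X)) = (2·S(2X)/(2X) − S(X)/X)/(2·N(2X)/(2X) −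
N(X)/X) → (4c − 2c)/(2c − c) = 2`. No rate is needed: the window holds half the mass. [folklore] -/
theorem windowMeanTwo_of_dh
    (h : Tendsto (fun X : ℕ =>
      (∑ D ∈ negFundDiscrs X, (quadFieldThreeTorsion D : ℝ)) / ((negFundDiscrs X).card : ℝ)) atTop (𝓝 2)) :
    Tendsto (fun n : ℕ =>
      (∑ D ∈ negFundDiscrs (2 ^ n) \ negFundDiscrs (2 ^ (n - 1)), (quadFieldThreeTorsion D : ℝ)) /
        ((negFundDiscrs (2 ^ n) \ negFundDiscrs (2 ^ (n - 1))).card : ℝ)) atTop (𝓝 2) := by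
  have hc : (0:ℝ) < 3 / Real.pi ^ 2 := by positivity
  have hS := tendsto_sum_div_of_dh h
  have hN := tendsto_card_negFundDiscrs_div
  -- along X = 2^n and X = 2^(n-1)
  have hp : Tendsto (fun n : ℕ => 2 ^ n) atTop atTop :=
    tendsto_pow_atTop_atTop_of_one_lt (by norm_num : (1:ℕ) < 2)
  have hp' : Tendsto (fun n : ℕ => 2 ^ (n - 1)) atTop atTop := hp.comp (tendsto_sub_atTop_nat 1)
  have hS1 : Tendsto (fun n : ℕ =>
      (∑ D ∈ negFundDiscrs (2 ^ n), (quadFieldThreeTorsion D : ℝ)) / ((2 ^ n : ℕ) : ℝ)) atTop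
      (𝓝 (2 * (3 / Real.pi ^ 2))) := hS.comp hp
  have hS0 : Tendsto (fun n : ℕ =>
      (∑ D ∈ negFundDiscrs (2 ^ (n - 1)), (quadFieldThreeTorsion D : ℝ)) / ((2 ^ (n - 1) : ℕ) : ℝ)) atTop
      (𝓝 (2 * (3 / Real.pi ^ 2))) := hS.comp hp'
  have hN1 : Tendsto (fun n : ℕ => ((negFundDiscrs (2 ^ n)).card : ℝ) / ((2 ^ n : ℕ) : ℝ)) atTop
      (𝓝 (3 / Real.pi ^ 2)) := hN.comp hp
  have hN0 : Tendsto (fun n : ℕ => ((negFundDiscrs (2 ^ (n - 1))).card : ℝ) / ((2 ^ (n - 1) : ℕ) : ℝ))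
      atTop (𝓝 (3 / Real.pi ^ 2)) := hN.comp hp'
  have hnum := (hS1.const_mul 2).sub hS0
  have hden := (hN1.const_mul 2).sub hN0
  have hne : 2 * (3 / Real.pi ^ 2) - 3 / Real.pi ^ 2 ≠ 0 := by
    rw [show 2 * (3 / Real.pi ^ 2) - 3 / Real.pi ^ 2 = 3 / Real.pi ^ 2 by ring]
    exact hc.ne'
  have key : (2 * (2 * (3 / Real.pi ^ 2)) - 2 * (3 / Real.pi ^ 2)) / (2 * (3 / Real.pi ^ 2) - 3 / Real.pi ^ 2)
      = 2 := by
    rw [show 2 * (2 * (3 / Real.pi ^ 2)) - 2 * (3 / Real.pi ^ 2) = 2 * (3 / Real.pi ^ 2) by ring,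
      show 2 * (3 / Real.pi ^ 2) - 3 / Real.pi ^ 2 = 3 / Real.pi ^ 2 by ring, mul_div_assoc,
      div_self hc.ne', mul_one]
  have hlim := hnum.div hden hne
  rw [key] at hlim
  refine hlim.congr' ?_
  filter_upwards [eventually_ge_atTop 1] with n hn
  have hP : (0:ℝ) < ((2 ^ (n - 1) : ℕ) : ℝ) := by positivity
  have h2P : ((2 ^ n : ℕ) : ℝ) = 2 * ((2 ^ (n - 1) : ℕ) : ℝ) := by
    obtain ⟨m, rfl⟩ : ∃ m, n = m + 1 := ⟨n - 1, by omega⟩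
    rw [Nat.add_sub_cancel, pow_succ]
    push_cast
    ring
  show (2 * ((∑ D ∈ negFundDiscrs (2 ^ n), (quadFieldThreeTorsion D : ℝ)) / ((2 ^ n : ℕ) : ℝ))
        - (∑ D ∈ negFundDiscrs (2 ^ (n - 1)), (quadFieldThreeTorsion D : ℝ)) / ((2 ^ (n - 1) : ℕ) : ℝ))
      / (2 * (((negFundDiscrs (2 ^ n)).card : ℝ) / ((2 ^ n : ℕ) : ℝ))
        - ((negFundDiscrs (2 ^ (n - 1))).card : ℝ) / ((2 ^ (n - 1) : ℕ) : ℝ))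
    = (∑ D ∈ negFundDiscrs (2 ^ n) \ negFundDiscrs (2 ^ (n - 1)), (quadFieldThreeTorsion D : ℝ)) /
        ((negFundDiscrs (2 ^ n) \ negFundDiscrs (2 ^ (n - 1))).card : ℝ)
  rw [h2P, sum_window_eq_sub, card_window_eq_sub]
  exact window_ratio_identity hP.ne'

/-! ## §2 The moment LP and the density floor (proved) -/

/-- Pointwise LP certificate on powers of three: `12·3^r − 9^r − 11 ≤ 16·[3^r > 1]` (equality at
`r = 1, 2`; negative from `r = 3` on). After triage-2's `TriageK2-LPLemma.lean`. [folklore] -/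
theorem lp_pointwise (r : ℕ) :
    12 * ((3:ℝ) ^ r) - ((3:ℝ) ^ r) ^ 2 - 11 ≤ 16 * (if 1 < 3 ^ r then (1:ℝ) else 0) := by
  rcases r with _ | _ | _ | r
  · norm_num
  · norm_num
  · norm_num
  · have h27 : (27:ℝ) ≤ (3:ℝ) ^ (r + 3) := by
      have : (3:ℝ) ^ 3 ≤ (3:ℝ) ^ (r + 3) := pow_le_pow_right₀ (by norm_num) (by omega)
      norm_num at this
      exact this
    have hlt : 1 < 3 ^ (r + 3) := Nat.one_lt_pow (by omega) (by norm_num)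
    rw [if_pos hlt]
    nlinarith [h27]

/-- **The moment LP** (card `moment-lp-density-floor`, First lemma; proved by triage-2): for every finite
set of integers, `12 Σ t − Σ t² − 11·#S ≤ 16 · #{D ∈ S : 1 < t(D)}` with `t = quadFieldThreeTorsion`
(a power of `3` everywhere, junk value `1 = 3⁰` off fundamental discriminants). [folklore] -/
theorem sixteen_mul_card_filter_one_lt_ge (S : Finset ℤ) :
    12 * (∑ D ∈ S, (quadFieldThreeTorsion D : ℝ)) - (∑ D ∈ S, ((quadFieldThreeTorsion D : ℝ)) ^ 2)
        - 11 * (S.card : ℝ)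
      ≤ 16 * ((S.filter (fun D => 1 < quadFieldThreeTorsion D)).card : ℝ) := by
  have hcard : ((S.filter (fun D => 1 < quadFieldThreeTorsion D)).card : ℝ)
      = ∑ D ∈ S, (if 1 < quadFieldThreeTorsion D then (1:ℝ) else 0) := by
    rw [Finset.sum_ite, Finset.sum_const_zero, add_zero, Finset.sum_const, nsmul_eq_mul, mul_one]
  have hS : (S.card : ℝ) = ∑ D ∈ S, (1:ℝ) := by
    rw [Finset.sum_const, nsmul_eq_mul, mul_one]
  rw [hcard, hS, Finset.mul_sum, Finset.mul_sum, Finset.mul_sum, ← Finset.sum_sub_distrib,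
    ← Finset.sum_sub_distrib]
  refine Finset.sum_le_sum fun D _ => ?_
  obtain ⟨r, hr⟩ := exists_quadFieldThreeTorsion_eq_pow D
  rw [hr]
  push_cast
  have := lp_pointwise r
  linarith

/-- **Density floor from two moments** (the card's `density_floor_of_second_moment`, for any sequence of
finite sets of integers): if the mean of `t` tends to `2` and eventually `Σ t² ≤ M₂ · #` with
`M₂ < 23/3`, then eventually the sets are nonempty and `#{1 < t} ≥ (1/3 + η)·#` with
`η = (23/3 − M₂)/32 > 0`. (LP: `16·#{1<t} ≥ 12Σt − Σt² − 11# ≥ (13 − M₂ − o(1))·#`, and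
`(13 − M₂)/16 > 1/3 ⟺ M₂ < 23/3`.) [folklore] -/
theorem densityFloor_of_moments (W : ℕ → Finset ℤ)
    (hM : Tendsto (fun n : ℕ =>
      (∑ D ∈ W n, (quadFieldThreeTorsion D : ℝ)) / ((W n).card : ℝ)) atTop (𝓝 2))
    (hS : ∃ M₂ : ℝ, M₂ < 23 / 3 ∧ ∀ᶠ n : ℕ in atTop,
      ∑ D ∈ W n, ((quadFieldThreeTorsion D : ℝ)) ^ 2 ≤ M₂ * ((W n).card : ℝ)) :
    ∃ η : ℝ, 0 < η ∧ ∀ᶠ n : ℕ in atTop, 0 < (W n).card ∧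
      (1 / 3 + η) * ((W n).card : ℝ) ≤ (((W n).filter (fun D => 1 < quadFieldThreeTorsion D)).card : ℝ) := by
  obtain ⟨M₂, hM₂, hS⟩ := hS
  obtain ⟨η, hη⟩ : ∃ η : ℝ, 32 * η = 23 / 3 - M₂ := ⟨(23 / 3 - M₂) / 32, by ring⟩
  obtain ⟨η', hη'⟩ : ∃ η' : ℝ, 24 * η' = 23 / 3 - M₂ := ⟨(23 / 3 - M₂) / 24, by ring⟩
  have hηpos : 0 < η := by linarith
  have hη'pos : 0 < η' := by linarith
  have hδ : 0 < min η' 1 := lt_min hη'pos one_pos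
  have h1 : ∀ᶠ n : ℕ in atTop,
      dist ((∑ D ∈ W n, (quadFieldThreeTorsion D : ℝ)) / ((W n).card : ℝ)) 2 < min η' 1 :=
    (Metric.tendsto_nhds.1 hM) _ hδ
  refine ⟨η, hηpos, ?_⟩
  filter_upwards [h1, hS] with n hn hSn
  rw [Real.dist_eq] at hn
  -- the window is nonempty (an empty window has mean `0`, at distance `2` from `2`)
  have hpos : 0 < (W n).card := by
    rw [Finset.card_pos]
    by_contra h0
    rw [Finset.not_nonempty_iff_eq_empty] at h0
    rw [h0, Finset.sum_empty, Finset.card_empty, Nat.cast_zero, div_zero, zero_sub, abs_neg,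
      abs_two] at hn
    have := min_le_right η' 1
    linarith
  refine ⟨hpos, ?_⟩
  have hN : (0:ℝ) < ((W n).card : ℝ) := by exact_mod_cast hpos
  -- first moment from below
  have hmean : 2 - η' < (∑ D ∈ W n, (quadFieldThreeTorsion D : ℝ)) / ((W n).card : ℝ) := by
    have h := (abs_lt.1 hn).1
    have := min_le_left η' 1
    linarith
  have hsum : 2 * ((W n).card : ℝ) - η' * ((W n).card : ℝ)
      < ∑ D ∈ W n, (quadFieldThreeTorsion D : ℝ) := by
    have := (lt_div_iff₀ hN).1 hmean
    rw [sub_mul] at this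
    exact this
  have hLP := sixteen_mul_card_filter_one_lt_ge (W n)
  have r1 : 32 * (η * ((W n).card : ℝ)) = 23 / 3 * ((W n).card : ℝ) - M₂ * ((W n).card : ℝ) := by
    rw [← mul_assoc, hη, sub_mul]
  have r2 : 24 * (η' * ((W n).card : ℝ)) = 23 / 3 * ((W n).card : ℝ) - M₂ * ((W n).card : ℝ) := by
    rw [← mul_assoc, hη', sub_mul]
  rw [add_mul]
  linarith

/-! ## §3 Window bookkeeping: the route's block of `d` versus the `ℤ`-window of `D = −d` (proved) -/

/-- The fundamental-discriminant predicate, literally as in `FundamentalDiscriminant.lean` /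
`negFundDiscrs` / the route file (a local NOTATION, not a declaration: statements below stay over
existing declarations only, and `Iff.rfl` matches the route's literal text). -/
local notation "IsFundZ(" D ")" =>
  ((D % 4 = 1 ∧ Squarefree D ∧ D ≠ 1) ∨ (4 ∣ D ∧ (D / 4 % 4 = 2 ∨ D / 4 % 4 = 3) ∧ Squarefree (D / 4)))

/-- `Finset.mem_filter` with the `DecidablePred` instance as an ordinary implicit argument, so that it
rewrites membership in a filter elaborated elsewhere (the route file's literal block, whose instance for
`Squarefree` on `ℤ` is the classical one) without re-synthesising the instance. [folklore] -/
theorem mem_filter' {α : Type*} {p : α → Prop} {inst : DecidablePred p} {s : Finset α} {a : α} :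
    a ∈ @Finset.filter α p inst s ↔ a ∈ s ∧ p a :=
  Finset.mem_filter

/-- Membership in the dyadic `ℤ`-window `𝒲ₙ = negFundDiscrs (2^n) \ negFundDiscrs (2^(n-1))`:
`−2ⁿ < D ≤ −2ⁿ⁻¹` and `D` fundamental. [folklore] -/
theorem mem_zWindow_iff (n : ℕ) (D : ℤ) :
    D ∈ negFundDiscrs (2 ^ n) \ negFundDiscrs (2 ^ (n - 1)) ↔
      (-((2 ^ n : ℕ) : ℤ) < D ∧ D ≤ -((2 ^ (n - 1) : ℕ) : ℤ)) ∧ IsFundZ(D) := by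
  rw [Finset.mem_sdiff, mem_negFundDiscrs, mem_negFundDiscrs]
  constructor
  · rintro ⟨⟨⟨h1, h2⟩, hf⟩, hnot⟩
    refine ⟨⟨h1, ?_⟩, hf⟩
    by_contra hle
    exact hnot ⟨⟨by omega, h2⟩, hf⟩
  · rintro ⟨⟨h1, h2⟩, hf⟩
    have hp : (0:ℤ) < ((2 ^ (n - 1) : ℕ) : ℤ) := by positivity
    exact ⟨⟨⟨h1, by omega⟩, hf⟩, fun h => by omega⟩

/-- **Transfer of filtered sums** from the `ℤ`-window to any finset of naturals `W` with the route
block's membership (`2ⁿ⁻¹ ≤ d < 2ⁿ`, `−d` fundamental), along `d ↦ −d` (inverse `D ↦ |D|`).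
Membership-based (`Finset.sum_nbij'`), hence independent of `Decidable` instances. [folklore] -/
theorem sum_filter_transfer {W : Finset ℕ} {n : ℕ}
    (hW : ∀ d, d ∈ W ↔ (2 ^ (n - 1) ≤ d ∧ d < 2 ^ n) ∧ IsFundZ(-(d:ℤ)))
    (p : ℤ → Prop) [DecidablePred p] (q : ℕ → Prop) [DecidablePred q]
    (hpq : ∀ d ∈ W, q d ↔ p (-(d:ℤ))) (g : ℤ → ℝ) :
    ∑ D ∈ (negFundDiscrs (2 ^ n) \ negFundDiscrs (2 ^ (n - 1))).filter p, g D
      = ∑ d ∈ W.filter q, g (-(d:ℤ)) := by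
  symm
  refine Finset.sum_nbij' (fun d : ℕ => -(d:ℤ)) (fun D : ℤ => D.natAbs) ?_ ?_ ?_ ?_ ?_
  · intro d hd
    rw [Finset.mem_filter] at hd
    obtain ⟨hdW, hq⟩ := hd
    have h := (hW d).1 hdW
    rw [Finset.mem_filter, mem_zWindow_iff]
    refine ⟨⟨⟨?_, ?_⟩, h.2⟩, (hpq d hdW).1 hq⟩
    · have : ((d:ℕ):ℤ) < ((2 ^ n : ℕ) : ℤ) := by exact_mod_cast h.1.2
      omega
    · have : ((2 ^ (n - 1) : ℕ) : ℤ) ≤ ((d:ℕ):ℤ) := by exact_mod_cast h.1.1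
      omega
  · intro D hD
    rw [Finset.mem_filter, mem_zWindow_iff] at hD
    obtain ⟨⟨⟨h1, h2⟩, hf⟩, hp⟩ := hD
    have hp0 : (0:ℤ) < ((2 ^ (n - 1) : ℕ) : ℤ) := by positivity
    have hDneg : D < 0 := by omega
    have hDeq : -((D.natAbs : ℕ) : ℤ) = D := by omega
    have hmem : D.natAbs ∈ W := by
      rw [hW]
      refine ⟨⟨?_, ?_⟩, by rw [hDeq]; exact hf⟩
      · have : ((2 ^ (n - 1) : ℕ) : ℤ) ≤ ((D.natAbs : ℕ) : ℤ) := by omega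
        exact_mod_cast this
      · have : ((D.natAbs : ℕ) : ℤ) < ((2 ^ n : ℕ) : ℤ) := by omega
        exact_mod_cast this
    rw [Finset.mem_filter]
    refine ⟨hmem, ?_⟩
    rw [hpq _ hmem, hDeq]
    exact hp
  · intro d _
    simp
  · intro D hD
    rw [Finset.mem_filter, mem_zWindow_iff] at hD
    obtain ⟨⟨⟨-, h2⟩, -⟩, -⟩ := hD
    have hp0 : (0:ℤ) < ((2 ^ (n - 1) : ℕ) : ℤ) := by positivity
    omega
  · intro d _
    rfl

/-- Unfiltered special case: `Σ_{𝒲ₙ} g(D) = Σ_{W} g(−d)`. [folklore] -/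
theorem sum_transfer {W : Finset ℕ} {n : ℕ}
    (hW : ∀ d, d ∈ W ↔ (2 ^ (n - 1) ≤ d ∧ d < 2 ^ n) ∧ IsFundZ(-(d:ℤ))) (g : ℤ → ℝ) :
    ∑ D ∈ negFundDiscrs (2 ^ n) \ negFundDiscrs (2 ^ (n - 1)), g D = ∑ d ∈ W, g (-(d:ℤ)) := by
  have h := sum_filter_transfer hW (fun _ => True) (fun _ => True) (fun _ _ => Iff.rfl) g
  simpa [Finset.filter_true] using h

/-- Cardinalities transfer (filtered). [folklore] -/
theorem card_filter_transfer {W : Finset ℕ} {n : ℕ}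
    (hW : ∀ d, d ∈ W ↔ (2 ^ (n - 1) ≤ d ∧ d < 2 ^ n) ∧ IsFundZ(-(d:ℤ)))
    (p : ℤ → Prop) [DecidablePred p] (q : ℕ → Prop) [DecidablePred q]
    (hpq : ∀ d ∈ W, q d ↔ p (-(d:ℤ))) :
    (((negFundDiscrs (2 ^ n) \ negFundDiscrs (2 ^ (n - 1))).filter p).card : ℝ)
      = ((W.filter q).card : ℝ) := by
  have h := sum_filter_transfer hW p q hpq (fun _ => (1:ℝ))
  simpa [Finset.sum_const] using h

/-- Cardinalities transfer (whole window). [folklore] -/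
theorem card_transfer {W : Finset ℕ} {n : ℕ}
    (hW : ∀ d, d ∈ W ↔ (2 ^ (n - 1) ≤ d ∧ d < 2 ^ n) ∧ IsFundZ(-(d:ℤ))) :
    (((negFundDiscrs (2 ^ n) \ negFundDiscrs (2 ^ (n - 1))).card : ℝ)) = (W.card : ℝ) := by
  have h := sum_transfer hW (fun _ => (1:ℝ))
  simpa [Finset.sum_const] using h

/-! ## §4 Semantics of the route's ensemble and the counting core (proved) -/

/-- **Bad mass is a counting ratio**: on a nonempty block `F n`, the probability of an event under
`uniform(F n)` pushed to strings is `#{d ∈ F n : bin d ∈ E} / #F n` (Disproof `ens_prob_eq`, for an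
abstract block). [folklore] -/
theorem prob_uniform_block_eq (F : ℕ → Finset ℕ) {n : ℕ} (h : (F n).Nonempty) (E : Set (List Bool)) :
    Ensemble.prob (fun n => if h : (F n).Nonempty then (PMF.uniformOfFinset (F n) h).map encodeNat
      else PMF.pure []) n E = (((F n).filter fun d => encodeNat d ∈ E).card : ℝ) / (F n).card := by
  unfold Ensemble.prob
  simp only []
  rw [dif_pos h, PMF.toOuterMeasure_map_apply, PMF.toOuterMeasure_uniformOfFinset_apply,
    ENNReal.toReal_div]
  simp only [Set.mem_preimage, ENNReal.toReal_natCast]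

/-- For a Boolean event, "not `false`" is "`true`". [folklore] -/
theorem setOf_ne_false : {b : Bool | b ≠ false} = {true} := by
  ext b
  cases b <;> simp

/-- **Counting core** (pure finite combinatorics): let `t : W → 3^ℕ`, and let `acc`, `bad` be predicates
such that every GOOD (`¬ bad`) member (`1 < t`) is accepted and every good non-member is rejected. Then
`#{1 < t} − #bad ≤ Σ_{acc} (t − 2)`: on accepted members `t − 2 ≥ 1`, on accepted non-members
`t − 2 = −1`, members missing from `acc` and non-members inside `acc` are all bad. [folklore] -/
theorem comb_core (W : Finset ℕ) (t : ℕ → ℕ) (ht : ∀ d ∈ W, ∃ r : ℕ, t d = 3 ^ r)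
    (acc bad : ℕ → Prop) [DecidablePred acc] [DecidablePred bad]
    (h1 : ∀ d ∈ W, ¬ bad d → 1 < t d → acc d)
    (h2 : ∀ d ∈ W, ¬ bad d → ¬ 1 < t d → ¬ acc d) :
    ((W.filter fun d => 1 < t d).card : ℝ) - ((W.filter bad).card : ℝ)
      ≤ ∑ d ∈ W.filter acc, ((t d : ℝ) - 2) := by
  -- split the accepted set into members / non-members
  have hsplit : ∑ d ∈ W.filter acc, ((t d : ℝ) - 2)
      = ∑ d ∈ (W.filter acc).filter (fun d => 1 < t d), ((t d : ℝ) - 2)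
        + ∑ d ∈ (W.filter acc).filter (fun d => ¬ 1 < t d), ((t d : ℝ) - 2) :=
    (Finset.sum_filter_add_sum_filter_not (W.filter acc) (fun d => 1 < t d) _).symm
  -- accepted members weigh at least `1` each
  have hmem : ((((W.filter acc).filter fun d => 1 < t d).card : ℝ))
      ≤ ∑ d ∈ (W.filter acc).filter (fun d => 1 < t d), ((t d : ℝ) - 2) := by
    have : ((((W.filter acc).filter fun d => 1 < t d).card : ℝ))
        = ∑ d ∈ (W.filter acc).filter (fun d => 1 < t d), (1:ℝ) := by
      rw [Finset.sum_const, nsmul_eq_mul, mul_one]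
    rw [this]
    refine Finset.sum_le_sum fun d hd => ?_
    rw [Finset.mem_filter] at hd
    obtain ⟨hdS, hlt⟩ := hd
    have hdW : d ∈ W := (Finset.mem_filter.1 hdS).1
    obtain ⟨r, hr⟩ := ht d hdW
    have h3 : 3 ≤ t d := by
      rw [hr] at hlt ⊢
      rcases r with _ | r
      · simp at hlt
      · calc (3:ℕ) = 3 ^ 1 := by norm_num
          _ ≤ 3 ^ (r + 1) := Nat.pow_le_pow_right (by norm_num) (by omega)
    have h3' : ((3:ℕ):ℝ) ≤ (t d : ℝ) := by exact_mod_cast h3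
    push_cast at h3'
    linarith
  -- accepted non-members weigh exactly `−1` each
  have hnon : ∑ d ∈ (W.filter acc).filter (fun d => ¬ 1 < t d), ((t d : ℝ) - 2)
      = - ((((W.filter acc).filter fun d => ¬ 1 < t d).card : ℝ)) := by
    have : ∑ d ∈ (W.filter acc).filter (fun d => ¬ 1 < t d), ((t d : ℝ) - 2)
        = ∑ d ∈ (W.filter acc).filter (fun d => ¬ 1 < t d), (-1:ℝ) := by
      refine Finset.sum_congr rfl fun d hd => ?_
      rw [Finset.mem_filter] at hd
      obtain ⟨hdS, hlt⟩ := hd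
      have hdW : d ∈ W := (Finset.mem_filter.1 hdS).1
      obtain ⟨r, hr⟩ := ht d hdW
      have h1' : t d = 1 := by
        rw [hr] at hlt ⊢
        rcases r with _ | r
        · simp
        · exfalso; exact hlt (Nat.one_lt_pow (by omega) (by norm_num))
      rw [h1']
      norm_num
    rw [this, Finset.sum_const, nsmul_eq_mul, mul_neg, mul_one]
  -- members outside `acc` are bad; accepted non-members are bad
  have hcover : W.filter (fun d => 1 < t d)
      ⊆ (W.filter acc).filter (fun d => 1 < t d) ∪ (W.filter bad).filter (fun d => 1 < t d) := by
    intro d hd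
    rw [Finset.mem_filter] at hd
    obtain ⟨hdW, hlt⟩ := hd
    rw [Finset.mem_union, Finset.mem_filter, Finset.mem_filter, Finset.mem_filter,
      Finset.mem_filter]
    by_cases hb : bad d
    · exact Or.inr ⟨⟨hdW, hb⟩, hlt⟩
    · exact Or.inl ⟨⟨hdW, h1 d hdW hb hlt⟩, hlt⟩
  have hsub : (W.filter acc).filter (fun d => ¬ 1 < t d)
      ⊆ (W.filter bad).filter (fun d => ¬ 1 < t d) := by
    intro d hd
    rw [Finset.mem_filter, Finset.mem_filter] at hd
    obtain ⟨⟨hdW, hacc⟩, hlt⟩ := hd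
    rw [Finset.mem_filter, Finset.mem_filter]
    refine ⟨⟨hdW, ?_⟩, hlt⟩
    by_contra hb
    exact h2 d hdW hb hlt hacc
  have k1 := Finset.card_le_card hcover
  have k2 := Finset.card_union_le ((W.filter acc).filter (fun d => 1 < t d))
    ((W.filter bad).filter (fun d => 1 < t d))
  have k3 := Finset.card_le_card hsub
  have k4 := Finset.card_filter_add_card_filter_not (s := W.filter bad) (fun d => 1 < t d)
  have k1' : ((W.filter (fun d => 1 < t d)).card : ℝ)
      ≤ (((W.filter acc).filter (fun d => 1 < t d)).card : ℝ)
        + (((W.filter bad).filter (fun d => 1 < t d)).card : ℝ) := by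
    exact_mod_cast k1.trans k2
  have k3' : (((W.filter acc).filter (fun d => ¬ 1 < t d)).card : ℝ)
      ≤ (((W.filter bad).filter (fun d => ¬ 1 < t d)).card : ℝ) := by exact_mod_cast k3
  have k4' : (((W.filter bad).filter (fun d => 1 < t d)).card : ℝ)
      + (((W.filter bad).filter (fun d => ¬ 1 < t d)).card : ℝ) = ((W.filter bad).card : ℝ) := by
    exact_mod_cast k4
  rw [hsplit, hnon]
  linarith

/-- **The core of the line (proved): density floor ∧ no-PPT-concentration ⇒ the crux, for an abstract
presentation of the route's language/ensemble.** `S` and `F` are any set / block with the membership of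
the route's literal `IQ3` set and dyadic block (so the route's own terms, with whatever `Decidable`
instances they carry, are only ever accessed through `hS`, `hF`). Argument: a `Heur_{1/3}` witness `A`
has bad mass `≤ 1/3` at EVERY level; at a level `n` where the window has `#{3 ∣ h} ≥ (1/3 + η)·#𝒲ₙ`
(hD, eventually) and `A`'s confidently-accepted set `S_A` has excess `≤ (η/2)·#𝒲ₙ` (hR, frequently),
`comb_core` gives `Σ_{S_A}(t − 2) ≥ #{3 ∣ h} − #bad ≥ η·#𝒲ₙ > (η/2)·#𝒲ₙ` — contradiction. Uses
`three_dvd_classNumber_iff_one_lt_quadFieldThreeTorsion`, `exists_quadFieldThreeTorsion_eq_pow`,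
`RandAlg.pr_ne_eq_one_sub`. [folklore] -/
theorem core {S : Set ℕ} {F : ℕ → Finset ℕ}
    (hmem : (⟨encodingNatBool.toLanguage S, fun n : ℕ => if h : (F n).Nonempty then
      (PMF.uniformOfFinset (F n) h).map encodeNat else PMF.pure []⟩ : DistProblem) ∈
        HeurDeltaBPP (fun _ => (1:ℝ) / 3))
    (hS : ∀ d, d ∈ S ↔ IsFundZ(-(d:ℤ)) ∧ 3 ∣ BinaryQuadraticForm.classNumber (-(d:ℤ)))
    (hF : ∀ n d, d ∈ F n ↔ (2 ^ (n - 1) ≤ d ∧ d < 2 ^ n) ∧ IsFundZ(-(d:ℤ)))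
    (hD : ∃ η : ℝ, 0 < η ∧ ∀ᶠ n : ℕ in atTop,
      0 < (negFundDiscrs (2 ^ n) \ negFundDiscrs (2 ^ (n - 1))).card ∧
      (1 / 3 + η) * ((negFundDiscrs (2 ^ n) \ negFundDiscrs (2 ^ (n - 1))).card : ℝ)
        ≤ (((negFundDiscrs (2 ^ n) \ negFundDiscrs (2 ^ (n - 1))).filter
            (fun D => 1 < quadFieldThreeTorsion D)).card : ℝ))
    (hR : ∀ A : RandAlg (List Bool × ℕ) Bool, A.IsPolyTime paramEnc encodeBool →
      ∀ ε : ℝ, 0 < ε → ∃ᶠ n : ℕ in atTop,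
        ∑ D ∈ (negFundDiscrs (2 ^ n) \ negFundDiscrs (2 ^ (n - 1))).filter
            (fun D => 3 / 4 < A.pr paramEnc (encodeNat D.natAbs, n) {true}),
          ((quadFieldThreeTorsion D : ℝ) - 2)
        ≤ ε * ((negFundDiscrs (2 ^ n) \ negFundDiscrs (2 ^ (n - 1))).card : ℝ)) :
    False := by
  obtain ⟨A, hA, hgood⟩ := hmem
  obtain ⟨η, hη, hDev⟩ := hD
  obtain ⟨n, hRn, hposn, hDn⟩ := ((hR A hA (η / 2) (half_pos hη)).and_eventually hDev).exists
  have hWmem : ∀ d, d ∈ F n ↔ (2 ^ (n - 1) ≤ d ∧ d < 2 ^ n) ∧ IsFundZ(-(d:ℤ)) := hF n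
  -- the indicator of the language on the block is `[1 < t(−d)]`
  have hind : ∀ d ∈ F n,
      (encodeNat d ∈ encodingNatBool.toLanguage S ↔ 1 < quadFieldThreeTorsion (-(d:ℤ))) := by
    intro d hd
    have hf := ((hWmem d).1 hd).2
    have hd0 : (-(d:ℤ)) < 0 := by
      have h2 : 2 ^ (n - 1) ≤ d := ((hWmem d).1 hd).1.1
      have : 0 < d := lt_of_lt_of_le (Nat.two_pow_pos _) h2
      omega
    rw [show encodeNat d = encodingNatBool.encode d from rfl, encodingNatBool.mem_toLanguage_iff,
      hS, ← three_dvd_classNumber_iff_one_lt_quadFieldThreeTorsion hf hd0]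
    exact ⟨fun h => h.2, fun h => ⟨hf, h⟩⟩
  -- transfer the three window quantities to the block `F n`
  have hcard := card_transfer hWmem
  have hposW : 0 < (F n).card := by
    have h : ((0:ℕ):ℝ) < ((F n).card : ℝ) := by
      rw [← hcard]; exact_mod_cast hposn
    exact_mod_cast h
  have hWne : (F n).Nonempty := Finset.card_pos.1 hposW
  have hN : (0:ℝ) < ((F n).card : ℝ) := by exact_mod_cast hposW
  have hI : (1 / 3 + η) * ((F n).card : ℝ)
      ≤ (((F n).filter (fun d : ℕ => 1 < quadFieldThreeTorsion (-(d:ℤ)))).card : ℝ) := by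
    rw [← hcard, ← card_filter_transfer hWmem (fun D : ℤ => 1 < quadFieldThreeTorsion D)
      (fun d : ℕ => 1 < quadFieldThreeTorsion (-(d:ℤ))) (fun _ _ => Iff.rfl)]
    exact hDn
  have hAcc : ∑ d ∈ (F n).filter (fun d : ℕ => 3 / 4 < A.pr paramEnc (encodeNat d, n) {true}),
      ((quadFieldThreeTorsion (-(d:ℤ)) : ℝ) - 2) ≤ η / 2 * ((F n).card : ℝ) := by
    rw [← hcard, ← sum_filter_transfer hWmem
      (fun D : ℤ => 3 / 4 < A.pr paramEnc (encodeNat D.natAbs, n) {true})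
      (fun d : ℕ => 3 / 4 < A.pr paramEnc (encodeNat d, n) {true})
      (fun d _ => by simp only [Int.natAbs_neg, Int.natAbs_natCast])
      (fun D => (quadFieldThreeTorsion D : ℝ) - 2)]
    exact hRn
  -- bad mass ≤ 1/3 as a count on the block
  have hB : (((F n).filter (fun d : ℕ => encodeNat d ∈
      {x | 1 / 4 ≤ A.pr paramEnc (x, n)
        {b | b ≠ (encodingNatBool.toLanguage S).boolIndicator x}})).card : ℝ)
      ≤ 1 / 3 * ((F n).card : ℝ) := by
    have hg : Ensemble.prob (fun n => if h : (F n).Nonempty then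
        (PMF.uniformOfFinset (F n) h).map encodeNat else PMF.pure []) n
        {x | 1 / 4 ≤ A.pr paramEnc (x, n)
          {b | b ≠ (encodingNatBool.toLanguage S).boolIndicator x}} ≤ 1 / 3 := hgood n
    rw [prob_uniform_block_eq F hWne, div_le_iff₀ hN] at hg
    exact hg
  -- the counting core on the block
  have h1 : ∀ d ∈ F n, ¬ (encodeNat d ∈
      {x | 1 / 4 ≤ A.pr paramEnc (x, n) {b | b ≠ (encodingNatBool.toLanguage S).boolIndicator x}}) →
      1 < quadFieldThreeTorsion (-(d:ℤ)) → 3 / 4 < A.pr paramEnc (encodeNat d, n) {true} := by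
    intro d hd hgoodd hlt
    simp only [Set.mem_setOf_eq, not_le] at hgoodd
    have hin : (encodingNatBool.toLanguage S).boolIndicator (encodeNat d) = true :=
      (Set.mem_iff_boolIndicator (s := encodingNatBool.toLanguage S) _).1 ((hind d hd).2 hlt)
    rw [hin, RandAlg.pr_ne_eq_one_sub] at hgoodd
    linarith
  have h2 : ∀ d ∈ F n, ¬ (encodeNat d ∈
      {x | 1 / 4 ≤ A.pr paramEnc (x, n) {b | b ≠ (encodingNatBool.toLanguage S).boolIndicator x}}) →
      ¬ 1 < quadFieldThreeTorsion (-(d:ℤ)) → ¬ 3 / 4 < A.pr paramEnc (encodeNat d, n) {true} := by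
    intro d hd hgoodd hlt hacc
    simp only [Set.mem_setOf_eq, not_le] at hgoodd
    have hout : (encodingNatBool.toLanguage S).boolIndicator (encodeNat d) = false :=
      (Set.notMem_iff_boolIndicator (s := encodingNatBool.toLanguage S) _).1
        (fun h => hlt ((hind d hd).1 h))
    rw [hout, setOf_ne_false] at hgoodd
    linarith
  have hcomb := comb_core (F n) (fun d : ℕ => quadFieldThreeTorsion (-(d:ℤ)))
    (fun d _ => exists_quadFieldThreeTorsion_eq_pow _)
    (fun d : ℕ => 3 / 4 < A.pr paramEnc (encodeNat d, n) {true})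
    (fun d : ℕ => encodeNat d ∈
      {x | 1 / 4 ≤ A.pr paramEnc (x, n) {b | b ≠ (encodingNatBool.toLanguage S).boolIndicator x}})
    h1 h2
  -- assemble: (1/3 + η)N ≤ #I, #B ≤ N/3, #I − #B ≤ Σ ≤ (η/2)N, N > 0
  rw [add_mul] at hI
  have e : η / 2 * ((F n).card : ℝ) = (η * ((F n).card : ℝ)) / 2 := by ring
  rw [e] at hAcc
  have hηN : 0 < η * ((F n).card : ℝ) := mul_pos hη hN
  linarith

/-! ## §5 The composition: the crux BY NAME from the three stubs -/

/-- **`AvgFaceBeyondPrior` from the line** — the only theorem of this file concluding the crux decl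
`Summit.QuantumAdvantage.QuantumAdvantage.Theses.ArithStatLadder.AvgFaceBeyondPrior`, by name, and
admit-free given the stubs: S1 ⟹ (`windowMeanTwo_of_dh`) window-DH; window-DH ∧ S2 ⟹ (moment LP,
`densityFloor_of_moments`) density floor; density floor ∧ S3 ⟹ (`core`) the crux. The route's literal
set / block / ensemble are matched by unification and accessed only through their membership
(`Iff.rfl`, `mem_filter'`). [folklore] -/
theorem AvgFaceBeyondPrior_of : AvgFaceBeyondPrior := by
  intro hmem
  exact core hmem (fun d => Iff.rfl) (fun n d => by rw [mem_filter', Finset.mem_Ico])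
    (densityFloor_of_moments (fun n => negFundDiscrs (2 ^ n) \ negFundDiscrs (2 ^ (n - 1)))
      (windowMeanTwo_of_dh stub_dhMeanImaginary) stub_secondMomentBelow)
    stub_noPPTConcentration

/-! ## §6 Consistency with the landed necessity lemma (proved) -/

/-- **S1 ∧ S2 deliver the Disproof's necessary condition, in its own terms, at every large level.**
The landed `Negative.avgFace_imp_exists_level` (`Theorems/AvgFaceBeyondPrior/Negative/
AvgFaceBeyondPriorNecessary.lean`) shows the crux forces SOME level `n` with
`#fundBlock n < 3 · #{d ∈ fundBlock n : 3 ∣ h(−d)}` (more than a third of the n-bit fundamental `−d` have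
`3 ∣ h`); the two arithmetic stubs give exactly this inequality for ALL large `n` (transport `𝒲ₙ ↔ fundBlock n`
along `d ↦ −d`, and `3 ∣ h(−d) ↔ 1 < #Cl₃(−d)`, `three_dvd_classNumber_iff_one_lt_quadFieldThreeTorsion`).
Stated with the stubs as HYPOTHESES (sorry-free). [folklore] -/
theorem existsLevel_of_moments
    (h₁ : Tendsto (fun X : ℕ =>
      (∑ D ∈ negFundDiscrs X, (quadFieldThreeTorsion D : ℝ)) / ((negFundDiscrs X).card : ℝ)) atTop (𝓝 2))
    (h₂ : ∃ M₂ : ℝ, M₂ < 23 / 3 ∧ ∀ᶠ n : ℕ in atTop,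
      ∑ D ∈ negFundDiscrs (2 ^ n) \ negFundDiscrs (2 ^ (n - 1)), ((quadFieldThreeTorsion D : ℝ)) ^ 2
        ≤ M₂ * ((negFundDiscrs (2 ^ n) \ negFundDiscrs (2 ^ (n - 1))).card : ℝ)) :
    ∀ᶠ n : ℕ in atTop, ((fundBlock n).card : ℝ) <
      3 * (((fundBlock n).filter fun d : ℕ => 3 ∣ BinaryQuadraticForm.classNumber (-(d:ℤ))).card : ℝ) := by
  obtain ⟨η, hη, hev⟩ := densityFloor_of_moments
    (fun n => negFundDiscrs (2 ^ n) \ negFundDiscrs (2 ^ (n - 1))) (windowMeanTwo_of_dh h₁) h₂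
  filter_upwards [hev] with n hn
  obtain ⟨hpos, hle⟩ := hn
  have hW : ∀ d, d ∈ fundBlock n ↔ (2 ^ (n - 1) ≤ d ∧ d < 2 ^ n) ∧ IsFundZ(-(d:ℤ)) := fun d => by
    simp only [fundBlock, Finset.mem_filter, Finset.mem_Ico]
  have hcard := card_transfer hW
  have hfilt := card_filter_transfer hW (fun D : ℤ => 1 < quadFieldThreeTorsion D)
    (fun d : ℕ => 3 ∣ BinaryQuadraticForm.classNumber (-(d:ℤ))) (fun d hd => by
      have hf := ((hW d).1 hd).2
      have hd0 : (-(d:ℤ)) < 0 := by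
        have h2 : 2 ^ (n - 1) ≤ d := ((hW d).1 hd).1.1
        have : 0 < d := lt_of_lt_of_le (Nat.two_pow_pos _) h2
        omega
      exact three_dvd_classNumber_iff_one_lt_quadFieldThreeTorsion hf hd0)
  rw [hcard, hfilt] at hle
  have hN : (0:ℝ) < ((fundBlock n).card : ℝ) := by
    rw [← hcard]
    exact_mod_cast hpos
  have hηN : 0 < η * ((fundBlock n).card : ℝ) := mul_pos hη hN
  rw [add_mul] at hle
  linarith

end Summit.QuantumAdvantage.QuantumAdvantage.Cruxes.AvgFaceBeyondPrior.MomentLpDensityFloor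

end
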